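import Summits.ResolutionOfSingularities.ResolutionOfSingularities.Theorems.FrobeniusLadderFInjectiveMacaulayficationNonFullLoopFloorTwo
import Summits.ResolutionOfSingularities.ResolutionOfSingularities.Theorems.FrobeniusLadderFInjectiveMacaulayficationKLocCellKitOff
import Summits.ResolutionOfSingularities.ResolutionOfSingularities.Theorems.FrobeniusLadderFInjectiveMacaulayficationKLocCellOff
import Summits.ResolutionOfSingularities.ResolutionOfSingularities.Theorems.FrobeniusLadderFInjectiveMacaulayficationPConeFedderData
import Literature.AlgebraicGeometry.Resolution.AffineBlowupCartier
import Summits.ResolutionOfSingularities.ResolutionOfSingularities.Theorems.FrobeniusLadderFInjectiveMacaulayficationNonFullLoopFloorOneLocus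
import HarnessLib

/-!
# NEG-N, FLOOR 2: ★★★ THE TWO-SIDED LOCUS LEMMA — a point of `U₂ = Spec k[x,y,u,t,z]/(g₂)`, `g₂ = z² + x⁴z + x²(y³+u³+t³)`, is NON-FULL **iff**
# it lies on `V(x̄, z̄)` (`char k = 2`); and the chart open immersion `U₃ ⟶ Bl_{(x̄,z̄)} U₂`
# (crux `FInjectiveMacaulayfication` stmt-ResolutionOfSingularities-15315, chain w45a; res-L1-w45a-plan-1 g19 RULINGS R19.21 «NEG-N» / R19.22 (NEG-2 → stub-3);
# sequel of this seat's `…NonFullLoopFloorTwo` (sub-centre chart identity, `exists_chartEquiv_x`, «⊇» half `not_fullCl_stalk_of_centre_le` at the height-one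
# prime `(x̄, z̄)`); floor table res-L1-w45a-tri-2 g16 (`k = 2: S₂ = (x, z), Bl (x,z) @x`; FIRST-STEP PASS `fl 2: D(x) ε = z, g = x² · D(z) ε = 1, g = z`);
# shape = res-L1-w45a-stub-1's ✓ `…NonFullLoopFloorFive` (Finset-image spelling of the centre); seat res-L1-w45a-stub-3 g10)

[OURS · L1 W4.5a] Support file (`--supports stmt-ResolutionOfSingularities-15315 --as helper`); replaces the role of NO printed item; NOT a statement of any
manuscript; def-free; UNCONDITIONAL; `CharP k 2` throughout. AI-written (AI review is weaker than expert review).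

`X 0 = x`, `X 1 = y`, `X 2 = u`, `X 3 = t`, `X 4 = z`; `A₂ = k[X]/(g₂)`, centre `𝔮 = (x̄, z̄) = Ideal.span ((fun j => mk (X j)) '' ↑({0, 4} : Finset (Fin 5)))`.
* §1 ★ `offCentre_clause` — `A₂` carries the CM + Frobenius-closed clause at every MAXIMAL ideal missing `x̄` or `z̄`: the p-basis split
  `g₂ = 1·z² + z·x⁴ + y·x²y² + u·x²u² + t·x²t²` has the two OFF-cells `x⁴ · z` (`h = x`, `m = 4`) and `z² · 1` — on `D(x)`, `D(z)` a split coefficient is a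
  unit, so `g₂ ∉ 𝔫^{[2]}` at every maximal `𝔫` there (Fedder) — ONE `decide +kernel` over `KLocCellKit.checkKsOff` and res-L1-w45a-stub-5's
  `KLocCellOff.honQuot_of_kLocCells_off`; `g₂_eq_evalL`, `not_X_dvd_g₂`;
* §2 ★★ `fullCl_localization_of_not_centre_le` / `fullCl_stalk_of_not_centre_le` — FULL at EVERY point `w` off `V(𝔮)` (Jacobson step +
  `ClauseOfMaximal.fiClause_atPrime_of_le` + `Spec.stalkIso`); ★★★ `not_fullCl_stalk_iff_centre_le : ∀ w, ¬ FullCl 2 𝒪_{U₂,w} ↔ (x̄, z̄) ≤ w` (+ localization twin):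
  the non-FULL locus of floor 2 IS the reduced threefold `V(x, z) ≅ 𝔸³_{y,u,t}` = the N-centre `S₂`, whose `x`-chart is `U₃`;
* §3 ★ `exists_chart_isOpenImmersion` — the scheme-level link `U₃ = Spec k[X]/(g₃) ⟶ Bl_{(x̄,z̄)} U₂`, an OPEN IMMERSION (`NonFullLoopFloorTwo.exists_chartEquiv_x` +
  Literature `affineBlowup.chartι` at `x̄`).
[cite: Fedder1983, Prop. 1.7 and Thm. 1.12] [cite: StacksProject, Tag 0804]
-/

-- single-problem summit: the doubled namespace component is forced
set_option linter.dupNamespace false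

noncomputable section

open AlgebraicGeometry CategoryTheory Literature.AlgebraicGeometry.Resolution TopologicalSpace IsLocalRing MvPolynomial

namespace Summit.ResolutionOfSingularities.ResolutionOfSingularities.Theorems.FInjectiveMacaulayfication.NonFullLoopFloorTwo

open Summit.ResolutionOfSingularities.ResolutionOfSingularities.Theorems.FInjectiveMacaulayfication
open SliceableCentre

variable (k : Type) [Field k]

/-! ## §1 `U₂` is F-pure (and CM) off `V(x̄, z̄)`: two OFF-cells -/

/-- `g₂` is the value of its term list. [plumbing] -/
theorem g₂_eq_evalL : (X 4 ^ 2 + X 0 ^ 4 * X 4 + X 0 ^ 2 * X 1 ^ 3 + X 0 ^ 2 * X 2 ^ 3 + X 0 ^ 2 * X 3 ^ 3 : MvPolynomial (Fin 5) k) =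
    KLocCellKit.evalL k [((1 : ℤ), ![0, 0, 0, 0, 2]), ((1 : ℤ), ![4, 0, 0, 0, 1]), ((1 : ℤ), ![2, 3, 0, 0, 0]), ((1 : ℤ), ![2, 0, 3, 0, 0]), ((1 : ℤ), ![2, 0, 0, 3, 0])] := by
  simp only [KLocCellKit.evalL, List.map_cons, List.map_nil, List.sum_cons, List.sum_nil, Int.cast_one, PConeFedderData.monomial_five]
  ring

/-- No variable divides `g₂` (`g₂(e_z) = 1`; `g₂(1,1,0,0,0) = 1`). [certificate] -/
theorem not_X_dvd_g₂ (g₂ : MvPolynomial (Fin 5) k) (hg₂ : g₂ = X 4 ^ 2 + X 0 ^ 4 * X 4 + X 0 ^ 2 * X 1 ^ 3 + X 0 ^ 2 * X 2 ^ 3 + X 0 ^ 2 * X 3 ^ 3)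
    (i : Fin 5) : ¬ ((X i : MvPolynomial (Fin 5) k) ∣ g₂) := by
  rintro ⟨c, hc⟩
  by_cases hi : i = 4
  · subst hi
    have := congrArg (MvPolynomial.eval ![(1 : k), 1, 0, 0, 0]) hc
    rw [hg₂] at this
    simp at this
  · have := congrArg (MvPolynomial.eval (Pi.single 4 1 : Fin 5 → k)) hc
    rw [hg₂] at this
    simp [hi] at this

set_option maxHeartbeats 800000 in
-- one kernel `decide` for the two off-cells + the off-cell engine
/-- ★ **`U₂` OFF THE CENTRE**: `k[X]/(g₂)` satisfies the CM + Frobenius-closed clause at every maximal ideal missing `x̄` or `z̄` (`char k = 2`). The two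
OFF-cells: `x⁴` is the split coefficient of the class `z` and `z²` that of the class `1`, so `x⁴, z² ∈ (split coefficients)` (Fedder: `g₂ ∉ 𝔫^{[2]}` when
`x ∉ 𝔫` or `z ∉ 𝔫`; tri-2 fl 2). NOT claimed at maximal ideals containing `(x̄, z̄)` (false there: `NonFullLoopFloorTwo.not_fullCl_localization_of_centre_le`).
[cite: Fedder1983, Prop. 1.7, Thm. 1.12] -/
theorem offCentre_clause [CharP k 2] (g₂ : MvPolynomial (Fin 5) k) (hg₂ : g₂ = X 4 ^ 2 + X 0 ^ 4 * X 4 + X 0 ^ 2 * X 1 ^ 3 + X 0 ^ 2 * X 2 ^ 3 + X 0 ^ 2 * X 3 ^ 3)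
    (Q' : Ideal (MvPolynomial (Fin 5) k ⧸ Ideal.span {g₂})) [Q'.IsMaximal]
    (hQ' : ∃ j ∈ ({0, 4} : Finset (Fin 5)), Ideal.Quotient.mk (Ideal.span {g₂}) (X j) ∉ Q') :
    ∀ d : ℕ, ringKrullDim (Localization.AtPrime Q') = d → ∀ s : Fin d → Localization.AtPrime Q',
      (Ideal.span (Set.range s)).radical.IsMaximal →
        RingTheory.Sequence.IsWeaklyRegular (Localization.AtPrime Q') (List.ofFn s) ∧
        ∀ y : Localization.AtPrime Q', (∃ n : ℕ, y ^ 2 ^ n ∈ Ideal.span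
          ((fun z : Localization.AtPrime Q' => z ^ 2 ^ n) '' (Ideal.span (Set.range s) : Set (Localization.AtPrime Q')))) → y ∈ Ideal.span (Set.range s) := by
  classical
  haveI : Fact (Nat.Prime 2) := ⟨Nat.prime_two⟩
  have hL := g₂_eq_evalL k
  have hX' := not_X_dvd_g₂ k g₂ hg₂
  have hg0' : g₂ ≠ 0 := fun h => hX' 0 (h ▸ dvd_zero _)
  have hf' : g₂ = KLocCellKit.evalL k [((1 : ℤ), ![0, 0, 0, 0, 2]), ((1 : ℤ), ![4, 0, 0, 0, 1]), ((1 : ℤ), ![2, 3, 0, 0, 0]), ((1 : ℤ), ![2, 0, 3, 0, 0]), ((1 : ℤ), ![2, 0, 0, 3, 0])] :=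
    hg₂.trans hL
  subst hf'
  have hcellsOff := KLocCellKit.offCells_of_check (K := k) 2
    [((1 : ℤ), ![0, 0, 0, 0, 2]), ((1 : ℤ), ![4, 0, 0, 0, 1]), ((1 : ℤ), ![2, 3, 0, 0, 0]), ((1 : ℤ), ![2, 0, 3, 0, 0]), ((1 : ℤ), ![2, 0, 0, 3, 0])]
    [(∅ : Finset (Fin 5))]
    [[((1 : ℤ), (Pi.single 0 1 : Fin 5 → ℕ))], [((1 : ℤ), (Pi.single 4 1 : Fin 5 → ℕ))]]
    [((∅ : Finset (Fin 5)), [(![0, 0, 0, 0, 1], [((1 : ℤ), ![0, 0, 0, 0, 0])])], (fun _ => []), [], [((1 : ℤ), (Pi.single 0 1 : Fin 5 → ℕ))], 4),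
      ((∅ : Finset (Fin 5)), [(![0, 0, 0, 0, 0], [((1 : ℤ), ![0, 0, 0, 0, 0])])], (fun _ => []), [], [((1 : ℤ), (Pi.single 4 1 : Fin 5 → ℕ))], 2)]
    (by decide +kernel) (by decide)
  have H := KLocCellOff.honQuot_of_kLocCells_off 2 k 5 (∅ : Finset (Fin 5)) (1 : Matrix (Fin 5) (Fin 5) ℕ)
    (KLocCellKit.evalL k [((1 : ℤ), ![0, 0, 0, 0, 2]), ((1 : ℤ), ![4, 0, 0, 0, 1]), ((1 : ℤ), ![2, 3, 0, 0, 0]), ((1 : ℤ), ![2, 0, 3, 0, 0]), ((1 : ℤ), ![2, 0, 0, 3, 0])])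
    hg0' hX' [] [(∅ : Finset (Fin 5))]
    (([[((1 : ℤ), (Pi.single 0 1 : Fin 5 → ℕ))], [((1 : ℤ), (Pi.single 4 1 : Fin 5 → ℕ))]] : List (List (ℤ × (Fin 5 → ℕ)))).map (KLocCellKit.evalL k))
    (fun T _ => Or.inr ⟨∅, by simp, Finset.empty_subset T⟩) (by simp) hcellsOff Q' (by simp) ?_
  · exact H.2
  · obtain ⟨j, hj, hjQ⟩ := hQ'
    simp only [Finset.mem_insert, Finset.mem_singleton] at hj
    rcases hj with rfl | rfl
    · exact ⟨_, List.mem_map.mpr ⟨_, by simp, NonFullLoopFloorOne.evalL_X k 0⟩, hjQ⟩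
    · exact ⟨_, List.mem_map.mpr ⟨_, by simp, NonFullLoopFloorOne.evalL_X k 4⟩, hjQ⟩

/-! ## §2 ★★ FULL at every point off `V(x̄, z̄)` (the «⊆» half), and the two-sided locus lemma -/

/-- ★★ **`FullCl 2 ((A₂)_P)` at EVERY prime `P ⊉ (x̄, z̄)`** (`char k = 2`): a maximal `Q' ⊇ P` missing the same generator exists (`A₂` is Jacobson), §1 gives the
clause at `Q'`, and the clause (with `IsDomain`) localizes from `Q'` to `P` (`ClauseOfMaximal.fiClause_atPrime_of_le`). [OURS · certificate; cite: Fedder1983, Thm. 1.12] -/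
theorem fullCl_localization_of_not_centre_le [CharP k 2] (g₂ : MvPolynomial (Fin 5) k) (hg₂ : g₂ = X 4 ^ 2 + X 0 ^ 4 * X 4 + X 0 ^ 2 * X 1 ^ 3 + X 0 ^ 2 * X 2 ^ 3 + X 0 ^ 2 * X 3 ^ 3)
    (P : Ideal (MvPolynomial (Fin 5) k ⧸ Ideal.span {g₂})) [P.IsPrime]
    (hP : ¬ Ideal.span ((fun j : Fin 5 => Ideal.Quotient.mk (Ideal.span {g₂}) (X j)) '' (({0, 4} : Finset (Fin 5)) : Set (Fin 5))) ≤ P) :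
    FullCl 2 (Localization.AtPrime P) := by
  haveI : Fact (Nat.Prime 2) := ⟨Nat.prime_two⟩
  haveI := (NonFullLoopFloorOne.isPrime_span_g₂ k _ rfl g₂ hg₂).2
  haveI : IsDomain (MvPolynomial (Fin 5) k ⧸ Ideal.span {g₂}) := Ideal.Quotient.isDomain _
  haveI : CharP (MvPolynomial (Fin 5) k ⧸ Ideal.span {g₂}) 2 := charP_of_injective_algebraMap (algebraMap k _).injective 2
  -- a generator outside `P`
  have hex : ∃ j ∈ ({0, 4} : Finset (Fin 5)), Ideal.Quotient.mk (Ideal.span {g₂}) (X j) ∉ P := by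
    by_contra hcon
    push Not at hcon
    exact hP (Ideal.span_le.mpr (by rintro _ ⟨j, hj, rfl⟩; exact hcon j hj))
  obtain ⟨j, hj, hjP⟩ := hex
  -- Jacobson: a maximal ideal `Q' ⊇ P` missing the same generator
  have hJ : P.jacobson = P := IsJacobsonRing.out inferInstance (Ideal.IsPrime.isRadical ‹_›)
  have hexQ : ∃ Q' : Ideal (MvPolynomial (Fin 5) k ⧸ Ideal.span {g₂}), Q'.IsMaximal ∧ P ≤ Q' ∧ Ideal.Quotient.mk (Ideal.span {g₂}) (X j) ∉ Q' := by
    by_contra hcon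
    push Not at hcon
    apply hjP
    rw [← hJ, Ideal.jacobson, Ideal.mem_sInf]
    rintro Q ⟨hPQ, hQ⟩
    exact hcon Q hQ hPQ
  obtain ⟨Q', hQ'max, hPQ', hjQ'⟩ := hexQ
  exact ClauseOfMaximal.fiClause_atPrime_of_le 2 hPQ' ⟨inferInstance, offCentre_clause k g₂ hg₂ Q' ⟨j, hj, hjQ'⟩⟩

/-- ★★ **THE «⊆» HALF OF THE FLOOR-2 LOCUS LEMMA** (stalk form): every point `w` of `U₂` with `¬ (x̄, z̄) ≤ w` is FULL (`char k = 2`). [OURS · certificate] -/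
theorem fullCl_stalk_of_not_centre_le [CharP k 2] (g₂ : MvPolynomial (Fin 5) k) (hg₂ : g₂ = X 4 ^ 2 + X 0 ^ 4 * X 4 + X 0 ^ 2 * X 1 ^ 3 + X 0 ^ 2 * X 2 ^ 3 + X 0 ^ 2 * X 3 ^ 3)
    (w : Spec (.of (MvPolynomial (Fin 5) k ⧸ Ideal.span {g₂})))
    (hw : ¬ Ideal.span ((fun j : Fin 5 => Ideal.Quotient.mk (Ideal.span {g₂}) (X j)) '' (({0, 4} : Finset (Fin 5)) : Set (Fin 5))) ≤ w.asIdeal) :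
    FullCl 2 ((Spec (.of (MvPolynomial (Fin 5) k ⧸ Ideal.span {g₂}))).presheaf.stalk w) :=
  WFixAtNonClosedDimTwo.fullCl_of_ringEquiv 2 (Spec.stalkIso (.of _) w).commRingCatIsoToRingEquiv.symm
    (fullCl_localization_of_not_centre_le k g₂ hg₂ w.asIdeal hw)

/-- ★★★ **THE FLOOR-2 LOCUS LEMMA, BOTH SIDES**: for `U₂ = Spec k[X]/(g₂)`, `g₂ = z² + x⁴z + x²(y³+u³+t³)`, `char k = 2`, a point `w` is NON-FULL **iff**
`(x̄, z̄) ≤ w`. So the non-FULL locus of floor 2 is the reduced threefold `V(x, z) ≅ 𝔸³_{y,u,t}` — the N-centre `S₂ = (x, z)` of tri-2's table, whose `x`-chart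
is `U₃` (`NonFullLoopFloorTwo.exists_chartEquiv_x`, §3). [OURS · certificate; cite: Fedder1983, Prop. 1.7 and Thm. 1.12] -/
theorem not_fullCl_stalk_iff_centre_le [CharP k 2] (g₂ : MvPolynomial (Fin 5) k) (hg₂ : g₂ = X 4 ^ 2 + X 0 ^ 4 * X 4 + X 0 ^ 2 * X 1 ^ 3 + X 0 ^ 2 * X 2 ^ 3 + X 0 ^ 2 * X 3 ^ 3) :
    ∀ w : Spec (.of (MvPolynomial (Fin 5) k ⧸ Ideal.span {g₂})),
      ¬ FullCl 2 ((Spec (.of (MvPolynomial (Fin 5) k ⧸ Ideal.span {g₂}))).presheaf.stalk w) ↔ Ideal.span ((fun j : Fin 5 => Ideal.Quotient.mk (Ideal.span {g₂}) (X j)) '' (({0, 4} : Finset (Fin 5)) : Set (Fin 5))) ≤ w.asIdeal :=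
  fun w => ⟨fun h => by_contra fun hw => h (fullCl_stalk_of_not_centre_le k g₂ hg₂ w hw), fun hw => not_fullCl_stalk_of_centre_le k g₂ hg₂ w hw⟩

/-- Localization form: `¬ FullCl 2 ((A₂)_P) ↔ (x̄, z̄) ≤ P` for every prime `P` of `A₂`. [OURS · certificate] -/
theorem not_fullCl_localization_iff_centre_le [CharP k 2] (g₂ : MvPolynomial (Fin 5) k) (hg₂ : g₂ = X 4 ^ 2 + X 0 ^ 4 * X 4 + X 0 ^ 2 * X 1 ^ 3 + X 0 ^ 2 * X 2 ^ 3 + X 0 ^ 2 * X 3 ^ 3)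
    (P : Ideal (MvPolynomial (Fin 5) k ⧸ Ideal.span {g₂})) [P.IsPrime] :
    ¬ FullCl 2 (Localization.AtPrime P) ↔ Ideal.span ((fun j : Fin 5 => Ideal.Quotient.mk (Ideal.span {g₂}) (X j)) '' (({0, 4} : Finset (Fin 5)) : Set (Fin 5))) ≤ P :=
  ⟨fun h => by_contra fun hP => h (fullCl_localization_of_not_centre_le k g₂ hg₂ P hP), fun hP => not_fullCl_localization_of_centre_le k g₂ hg₂ P hP⟩

/-! ## §3 ★ The chart open immersion `U₃ ⟶ Bl_{(x̄,z̄)} U₂` -/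

/-- ★ **THE FLOOR-2 → FLOOR-3 LINK AT SCHEME LEVEL**: `U₃ = Spec k[X]/(g₃)` is an OPEN SUBSCHEME of `Bl_{(x̄,z̄)} U₂` — the composite of the iso `Spec` of
`NonFullLoopFloorTwo.exists_chartEquiv_x` with the chart `affineBlowup.chartι` at `x̄`. [folklore assembly; cite: StacksProject, Tag 0804] -/
theorem exists_chart_isOpenImmersion [CharP k 2] (g₂ : MvPolynomial (Fin 5) k) (hg₂ : g₂ = X 4 ^ 2 + X 0 ^ 4 * X 4 + X 0 ^ 2 * X 1 ^ 3 + X 0 ^ 2 * X 2 ^ 3 + X 0 ^ 2 * X 3 ^ 3)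
    (g₃ : MvPolynomial (Fin 5) k) (hg₃ : g₃ = X 4 ^ 2 + X 0 ^ 3 * X 4 + X 1 ^ 3 + X 2 ^ 3 + X 3 ^ 3) :
    ∃ j : Spec (.of (MvPolynomial (Fin 5) k ⧸ Ideal.span {g₃})) ⟶ affineBlowup (Ideal.span ((fun j : Fin 5 => Ideal.Quotient.mk (Ideal.span {g₂}) (X j)) '' (({0, 4} : Finset (Fin 5)) : Set (Fin 5)))),
      IsOpenImmersion j := by
  obtain ⟨e, -⟩ := exists_chartEquiv_x k g₂ hg₂ g₃ hg₃
  exact ⟨Spec.map e.symm.toCommRingCatIso.hom ≫ affineBlowup.chartι (I := Ideal.span ((fun j : Fin 5 => Ideal.Quotient.mk (Ideal.span {g₂}) (X j)) '' (({0, 4} : Finset (Fin 5)) : Set (Fin 5))))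
      (Ideal.Quotient.mk (Ideal.span {g₂}) (X 0))
      (StrictTransformChartSub.mem_centre (fun j : Fin 5 => Ideal.Quotient.mk (Ideal.span {g₂}) (X j)) ({0, 4} : Finset (Fin 5)) (i := 0) (by simp)),
    inferInstance⟩

end Summit.ResolutionOfSingularities.ResolutionOfSingularities.Theorems.FInjectiveMacaulayfication.NonFullLoopFloorTwo

end
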